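import Summits.ResolutionOfSingularities.ResolutionOfSingularities.Theorems.FrobeniusLadderFInjectiveMacaulayficationLx3p3ShiftNewtonKFan
import Summits.ResolutionOfSingularities.ResolutionOfSingularities.Theorems.FrobeniusLadderFInjectiveMacaulayficationLx3p3ShiftPointFloor
import Summits.ResolutionOfSingularities.ResolutionOfSingularities.Theorems.FrobeniusLadderFInjectiveMacaulayficationFHalfRowOfWeaklyNondegenerate
import Summits.ResolutionOfSingularities.ResolutionOfSingularities.Theorems.FrobeniusLadderFInjectiveMacaulayficationFHalfRowOfToricCoverData
import Summits.ResolutionOfSingularities.ResolutionOfSingularities.Theorems.FrobeniusLadderFInjectiveMacaulayficationPolyAutRowTransport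
import HarnessLib

/-!
# ★★★ CLASS-ROUTE COVERAGE PROGRAMME, BED T: `f_T′ = σ(f_T) = z² − x⁸ + y⁴ + u⁴ + t⁵` (char 3) BY THE CLASS THEOREM — the point floor of `V(f_T′)` is cured by the monomial blowing
# up `𝔪·K` read off the `Σ_f ∧ Σ(𝔪)` fan (103 charts), with NO Fedder cell — and, by transport along `σ : z ↦ z + x⁴` (res-L1-w45a-stub-1ʼs `PolyAutRowTransport`), THE
# POINT-FLOOR ROW AND THE GERM ROW OF BED T `z² + x⁴z + y⁴ + u⁴ + t⁵` (not convenient in `x`: no 𝔪-primary Σ_f-refining fan for BED T itself, R21.39 (1)) RE-PROVED THROUGH (B″)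
# (crux `FInjectiveMacaulayfication` stmt-ResolutionOfSingularities-15315, chain w45a; res-L1-w45a-plan-1 RULING R22.14 (1) «CLASS-ROUTE COVERAGE PROGRAMME — (1) BED T»; seat
# res-L1-w45a-stub-2 g11; template = this seatʼs pilot ✓ p681805 `Sigma5P2d4CPointFloorRowClass`; cells route of record = ✓ p674181 `Lx3p3PointFloorRow.f4pos_p3_rowT`)

[OURS · L1 W4.5a] Support file (`--supports stmt-ResolutionOfSingularities-15315 --as helper`); def-free, unconditional; replaces the role of NO printed item;
NOT a statement of the manuscript; AI-written (AI review is weaker than expert review). A cross-certificate of a census row, OURS counted 0; nothing of the crux is proved.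

`X′ = Spec (k[X₀..X₄]/(f_T′))`, `f_T′ = X4 ^ 2 - X0 ^ 8 + X1 ^ 4 + X2 ^ 4 + X3 ^ 5`, `k = k̄` of characteristic 3, `v` = the vertex, floor centre `𝔪 = (x̄, ȳ, ū, t̄, z̄)`,
`A = 𝔪·K` = `genSet 5 Lx3p3ShiftNewtonKFan.AL2` (1685 generators, `K` 𝔪-primary, `|K| = 337`; fan `Lx3p3s4_fan.json` a9c6dfec19b8da6a, certificate `Lx3p3s4_cover.json` 52dc9a588ccf0aa3).
* §0 `exists_refining_strictTransform`; §1 `affineBlowup_mK_fullCl_class` (✓ p656605 §2); §2 ★★ `pointFloor_shiftT_row_class` (the cure, ✓ p656605 §3);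
* §3 ★★ `f4pos_row_shiftT_class` = LEGAL ∧ NOT F(4)-iso (p = 3) ∧ CURED for `V(f_T′)` (input side `Lx3p3ShiftPointFloor`); §4 ★ `shiftT_fInjectivizationGermAt : FInjectivizationGermAt 3 v`;
* §5 `aeval_shift_fT` (`σ f_T = f_T′` in char 3), ★★★ `pointFloorRow_bedT_class` / `bedT_fInjectivizationGermAt_class` — the same two statements for BED T `f_T = X4 ^ 2 + X0 ^ 4 * X4 + X1 ^ 4 +
  X2 ^ 4 + X3 ^ 5` by `PolyAutRowTransport.exists_translate k 0 4 _ 1 4` + `pointFloorRow_of_algEquiv 3` / `fInjectivizationGermAt_of_algEquiv 3`: a SECOND, independent kernel proof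
  of the cure half of ✓ p674181 (17-chart positive-ray thin-cell fan there; 103-chart Newton fan + weak non-degeneracy + shift here). `k = k̄` is the one extra hypothesis.
[OURS · certificate instance + assembly of landed theorems] [cite: IshiiSingularities2018, Thm. 4.4.23, Lemma 4.4.24, Cor. 4.4.25 (pp. 95–97)] [cite: StacksProject, Tag 080A]
[cite: GortzWedhorn2020, Prop. 13.91 (2), (13.19)]
-/

-- single-problem summit: the doubled namespace component is forced
set_option linter.dupNamespace false

noncomputable section

open AlgebraicGeometry CategoryTheory Literature.AlgebraicGeometry.Resolution TopologicalSpace IsLocalRing MvPolynomial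

namespace Summit.ResolutionOfSingularities.ResolutionOfSingularities.Theorems.FInjectiveMacaulayfication.Lx3p3ShiftPointFloorRowClass

open Summit.ResolutionOfSingularities.ResolutionOfSingularities.Theorems.FInjectiveMacaulayfication
open SliceableCentre GermForm FanCheckKit Lx3p3ShiftNewtonKFan

/-! ## §0 The refining strict transforms from the Newton minimisers -/

/-- On every chart of the `Σ_f ∧ Σ(𝔪)` fan, `θ_{V c} f_T′ = Y^{V c · u₀ c} · g_c` with `g_c(0) ≠ 0` — the Newton chart lemma on the tabulated common minimiser.
[cite: IshiiSingularities2018, proof of Lemma 4.4.24 (p. 96)] -/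
theorem exists_refining_strictTransform (k : Type) [Field k] (f : MvPolynomial (Fin 5) k)
    (hf : f = X 4 ^ 2 - X 0 ^ 8 + X 1 ^ 4 + X 2 ^ 4 + X 3 ^ 5) (c : Fin 103) :
    ∃ g : MvPolynomial (Fin 5) k, aeval (fun j : Fin 5 => ∏ i : Fin 5, (X i : MvPolynomial (Fin 5) k) ^ Vq c i j) f =
      monomial (Finsupp.equivFunOnFinite.symm ((Vq c).mulVec ⇑(Finsupp.equivFunOnFinite.symm (U0 c) : Fin 5 →₀ ℕ))) 1 * g ∧ constantCoeff g ≠ 0 :=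
  NewtonChartLemma.exists_theta_eq_monomial_mul_of_commonMinimiser (Vq c) (hV c) f _ (hu₀ k f hf c) (hmin k f hf c)

/-! ## §1 `Bl_{𝔪·K} X′` is FULL everywhere -/

/-- ★ **`Bl_{𝔪·K} V(f_T′)` IS FULL AT EVERY POINT** (class route: weak non-degeneracy + Newton fan cover data; no Fedder cell). [OURS · certificate instance]
[cite: IshiiSingularities2018, Thm. 4.4.23 and Cor. 4.4.25] -/
theorem affineBlowup_mK_fullCl_class (k : Type) [Field k] [IsAlgClosed k] [CharP k 3] (f : MvPolynomial (Fin 5) k)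
    (hf : f = X 4 ^ 2 - X 0 ^ 8 + X 1 ^ 4 + X 2 ^ 4 + X 3 ^ 5) :
    ∀ y : ↥(affineBlowup (Ideal.span ((fun e : Fin 5 →₀ ℕ => Ideal.Quotient.mk (Ideal.span {f}) (monomial e (1 : k))) '' (genSet 5 AL2 : Set (Fin 5 →₀ ℕ))))),
      FullCl 3 ((affineBlowup (Ideal.span ((fun e : Fin 5 →₀ ℕ => Ideal.Quotient.mk (Ideal.span {f}) (monomial e (1 : k))) '' (genSet 5 AL2 : Set (Fin 5 →₀ ℕ))))).presheaf.stalk y) := by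
  classical
  haveI : Fact (Nat.Prime 3) := ⟨Nat.prime_three⟩
  choose g hθ hg0 using exists_refining_strictTransform k f hf
  exact FHalfRowOfNewtonNondegenerate.affineBlowup_fullCl_of_weaklyNondegenerate 3 k f (Lx3p3ShiftSpecimen.prime_f k f hf)
    (Lx3p3ShiftSpecimen.weaklyNondegenerate k f hf) (Lx3p3ShiftSpecimen.mk_X_ne_zero k f hf)
    (fun x hx => Lx3p3ShiftSpecimen.regular_off_vertex k f hf x.asIdeal hx)
    (genSet 5 AL2) hprimAJ.2.1 hprimAJ.1 103 (chartM 5 AL2 CL 103) (hcov k) Vq hV (chartA 5 AL2 CL 103) haA hgen hge g _ hθ hg0 (Lx3p3ShiftNewtonKFan.hv k _)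

/-! ## §2 ★★ The cure of the point floor, by the class theorem -/

/-- ★★ **THE POINT FLOOR OF `V(f_T′)` IS CURED — BY THE CLASS THEOREM** (`k = k̄`, char 3). See the module docstring. [OURS · certificate instance]
[cite: IshiiSingularities2018, Thm. 4.4.23 and Cor. 4.4.25] [cite: StacksProject, Tag 080A] -/
theorem pointFloor_shiftT_row_class (k : Type) [Field k] [IsAlgClosed k] [CharP k 3] (f : MvPolynomial (Fin 5) k)
    (hf : f = X 4 ^ 2 - X 0 ^ 8 + X 1 ^ 4 + X 2 ^ 4 + X 3 ^ 5)
    (v : Spec (.of (MvPolynomial (Fin 5) k ⧸ Ideal.span {f})))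
    (hv : v.asIdeal = Ideal.span (Set.range (fun j : Fin 5 => Ideal.Quotient.mk (Ideal.span {f}) (X j)))) :
    ∀ (S' : Scheme.{0}) (g : S' ⟶ Spec ((Spec (.of (MvPolynomial (Fin 5) k ⧸ Ideal.span {f}))).presheaf.stalk v)),
      IsBlowup g ((affineBlowup.idealSheaf (Ideal.span (Set.range (fun j : Fin 5 => Ideal.Quotient.mk (Ideal.span {f}) (X j))))).comap
        ((Spec (.of (MvPolynomial (Fin 5) k ⧸ Ideal.span {f}))).fromSpecStalk v)) →
      ∃ 𝓚 : S'.IdealSheafData, 𝓚 ≠ ⊥ ∧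
        (∀ s ∈ (𝓚.support : Set S'), g.base s = closedPoint ((Spec (.of (MvPolynomial (Fin 5) k ⧸ Ideal.span {f}))).presheaf.stalk v)) ∧
        ∀ (S'' : Scheme.{0}) (π : S'' ⟶ S'), IsBlowup π 𝓚 → ∀ s : S'', FullCl 3 (S''.presheaf.stalk s) := by
  classical
  haveI : Fact (Nat.Prime 3) := ⟨Nat.prime_three⟩
  choose g hθ hg0 using exists_refining_strictTransform k f hf
  exact FHalfRowOfNewtonNondegenerate.fHalfRow_of_weaklyNondegenerate 3 k (by norm_num) f (Lx3p3ShiftSpecimen.prime_f k f hf)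
    (Lx3p3ShiftSpecimen.weaklyNondegenerate k f hf) (Lx3p3ShiftSpecimen.mk_X_ne_zero k f hf)
    (fun x hx => Lx3p3ShiftSpecimen.regular_off_vertex k f hf x.asIdeal hx)
    (genSet 5 AL2) (genSet 5 KL2) (span_A_eq_floor_mul_K k _).1 hKprim.1 hprimAJ.2.1 hprimAJ.1 103 (chartM 5 AL2 CL 103) (hcov k) Vq hV
    (chartA 5 AL2 CL 103) haA hgen hge g _ hθ hg0 (Lx3p3ShiftNewtonKFan.hv k _) v hv

/-! ## §3 ★★ The two-sided row for `V(f_T′)`, by the class route -/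

/-- ★★ **THE TWO-SIDED ROW FOR `V(f_T′)` AT THE POINT FLOOR: LEGAL ∧ NOT F(4)-iso (p = 3) ∧ CURED** (`k = k̄`). The first two conjuncts are this seatʼs `Lx3p3ShiftPointFloor`
(input side), the third is §2. [OURS · assembly of landed theorems] -/
theorem f4pos_row_shiftT_class (k : Type) [Field k] [IsAlgClosed k] [CharP k 3] (f : MvPolynomial (Fin 5) k)
    (hf : f = X 4 ^ 2 - X 0 ^ 8 + X 1 ^ 4 + X 2 ^ 4 + X 3 ^ 5)
    (v : Spec (.of (MvPolynomial (Fin 5) k ⧸ Ideal.span {f})))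
    (hv : v.asIdeal = Ideal.span (Set.range (fun j : Fin 5 => Ideal.Quotient.mk (Ideal.span {f}) (X j))))
    (S' : Scheme.{0}) (g : S' ⟶ Spec ((Spec (.of (MvPolynomial (Fin 5) k ⧸ Ideal.span {f}))).presheaf.stalk v))
    (hg : IsBlowup g ((affineBlowup.idealSheaf (Ideal.span (Set.range (fun j : Fin 5 => Ideal.Quotient.mk (Ideal.span {f}) (X j))))).comap
      ((Spec (.of (MvPolynomial (Fin 5) k ⧸ Ideal.span {f}))).fromSpecStalk v))) :
    (((affineBlowup.idealSheaf (Ideal.span (Set.range (fun j : Fin 5 => Ideal.Quotient.mk (Ideal.span {f}) (X j))))).comap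
        ((Spec (.of (MvPolynomial (Fin 5) k ⧸ Ideal.span {f}))).fromSpecStalk v)) ≠ ⊥ ∧
      (((((affineBlowup.idealSheaf (Ideal.span (Set.range (fun j : Fin 5 => Ideal.Quotient.mk (Ideal.span {f}) (X j))))).comap
        ((Spec (.of (MvPolynomial (Fin 5) k ⧸ Ideal.span {f}))).fromSpecStalk v))).support :
          Set (Spec ((Spec (.of (MvPolynomial (Fin 5) k ⧸ Ideal.span {f}))).presheaf.stalk v))) ⊆
        (Scheme.regularLocus (Spec ((Spec (.of (MvPolynomial (Fin 5) k ⧸ Ideal.span {f}))).presheaf.stalk v)))ᶜ) ∧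
      (∀ s : S', g.base s ≠ closedPoint ((Spec (.of (MvPolynomial (Fin 5) k ⧸ Ideal.span {f}))).presheaf.stalk v) → s ∈ Scheme.regularLocus S') ∧
      (∀ s : S', CMCl (S'.presheaf.stalk s))) ∧
    (∃ s : S', g.base s = closedPoint ((Spec (.of (MvPolynomial (Fin 5) k ⧸ Ideal.span {f}))).presheaf.stalk v) ∧ ¬ FullCl 3 (S'.presheaf.stalk s)) ∧
    (∃ 𝓚 : S'.IdealSheafData, 𝓚 ≠ ⊥ ∧
      (∀ s ∈ (𝓚.support : Set S'), g.base s = closedPoint ((Spec (.of (MvPolynomial (Fin 5) k ⧸ Ideal.span {f}))).presheaf.stalk v)) ∧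
      ∀ (S'' : Scheme.{0}) (π : S'' ⟶ S'), IsBlowup π 𝓚 → ∀ s : S'', FullCl 3 (S''.presheaf.stalk s)) :=
  ⟨Lx3p3ShiftPointFloor.pointFloor_shiftT_input_legal k f hf v hv S' g hg, Lx3p3ShiftPointFloor.pointFloor_shiftT_not_full k f hf v hv S' g hg,
    pointFloor_shiftT_row_class k f hf v hv S' g hg⟩

/-! ## §4 ★ The germ shape for `V(f_T′)` -/

/-- ★ **`FInjectivizationGermAt 3 v` AT THE VERTEX OF `V(f_T′)`** (`k = k̄`, char 3): one `𝔪`-primary monomial blowing up of `Spec 𝒪_{X′,v}` (along `𝔪·K`) is FULL at every stalk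
(§1 + ✓ `GermOfGlobalBlowup.fInjectivizationGermAt_of_affineBlowup`). [OURS · certificate instance; cite: GortzWedhorn2020, Prop. 13.91 (2)] -/
theorem shiftT_fInjectivizationGermAt (k : Type) [Field k] [IsAlgClosed k] [CharP k 3] (f : MvPolynomial (Fin 5) k)
    (hf : f = X 4 ^ 2 - X 0 ^ 8 + X 1 ^ 4 + X 2 ^ 4 + X 3 ^ 5)
    (v : Spec (.of (MvPolynomial (Fin 5) k ⧸ Ideal.span {f})))
    (hv : v.asIdeal = Ideal.span (Set.range (fun j : Fin 5 => Ideal.Quotient.mk (Ideal.span {f}) (X j)))) :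
    FInjectivizationGermAt 3 v := by
  classical
  haveI hp : (Ideal.span {f}).IsPrime := Lx3p3ShiftSpecimen.isPrime_span_f k f hf
  haveI : IsDomain (MvPolynomial (Fin 5) k ⧸ Ideal.span {f}) := Ideal.Quotient.isDomain _
  have hpow : ∀ j : Fin 5, ∃ N : ℕ, (Ideal.Quotient.mk (Ideal.span {f}) (X j)) ^ N ∈
      Ideal.span ((fun e : Fin 5 →₀ ℕ => Ideal.Quotient.mk (Ideal.span {f}) (monomial e (1 : k))) '' (genSet 5 AL2 : Set (Fin 5 →₀ ℕ))) := by
    intro j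
    obtain ⟨N, hN⟩ := hprimAJ.2.1 j (Finset.mem_univ j)
    refine ⟨N, ?_⟩
    have e : (Ideal.Quotient.mk (Ideal.span {f}) (X j)) ^ N = Ideal.Quotient.mk (Ideal.span {f}) (monomial (Finsupp.single j N) (1 : k)) := by
      rw [← map_pow, X_pow_eq_monomial]
    rw [e]
    exact Ideal.subset_span ⟨_, Finset.mem_coe.mpr hN, rfl⟩
  refine GermOfGlobalBlowup.fInjectivizationGermAt_of_affineBlowup 3 _ ?_ v ?_ (affineBlowup_mK_fullCl_class k f hf)
  · obtain ⟨N, hN⟩ := hpow 0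
    intro hbot
    rw [hbot, Ideal.mem_bot] at hN
    exact pow_ne_zero N (Lx3p3ShiftSpecimen.mk_X_ne_zero k f hf 0) hN
  · rw [hv, Ideal.span_le]
    rintro _ ⟨j, rfl⟩
    obtain ⟨N, hN⟩ := hpow j
    exact ⟨N, hN⟩

/-! ## §5 ★★★ TRANSPORT TO BED T (res-L1-w45a-stub-1ʼs `PolyAutRowTransport`) -/

/-- **`σ f_T = f_T′`** (`σ : z ↦ z + x⁴`, characteristic 3): `(z + x⁴)² + x⁴(z + x⁴) + y⁴ + u⁴ + t⁵ = z² + 3x⁴z + 2x⁸ + … = z² − x⁸ + y⁴ + u⁴ + t⁵`. [folklore] -/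
theorem aeval_shift_fT (k : Type) [Field k] [CharP k 3] (f f' : MvPolynomial (Fin 5) k) (hf : f = X 4 ^ 2 + X 0 ^ 4 * X 4 + X 1 ^ 4 + X 2 ^ 4 + X 3 ^ 5)
    (hf' : f' = X 4 ^ 2 - X 0 ^ 8 + X 1 ^ 4 + X 2 ^ 4 + X 3 ^ 5) :
    aeval (fun l : Fin 5 => if l = 4 then X 4 + C (1 : k) * X 0 ^ 4 else (X l : MvPolynomial (Fin 5) k)) f = f' := by
  have h3 : (3 : MvPolynomial (Fin 5) k) = 0 := by
    have h := CharP.cast_eq_zero (MvPolynomial (Fin 5) k) 3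
    simpa using h
  have e : aeval (fun l : Fin 5 => if l = 4 then X 4 + C (1 : k) * X 0 ^ 4 else (X l : MvPolynomial (Fin 5) k)) f = f' + 3 * (X 0 ^ 4 * X 4 + X 0 ^ 8) := by
    subst hf hf'
    simp only [map_add, map_mul, map_pow, aeval_X, C_1, one_mul]
    simp only [Fin.isValue, Fin.reduceEq, if_false, if_true]
    ring
  rw [e, h3, zero_mul, add_zero]

/-- ★★★ **THE POINT-FLOOR ROW OF BED T `z² + x⁴z + y⁴ + u⁴ + t⁵` (char 3, `k = k̄`) — LEGAL ∧ NOT F(4)-iso ∧ CURED — RE-PROVED THROUGH THE CLASS ROUTE** (the cells route is ✓ p674181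
`Lx3p3PointFloorRow.f4pos_p3_rowT`): §3 for `f_T′ = σ f_T` transported along `σ : z ↦ z + x⁴` by res-L1-w45a-stub-1ʼs `PolyAutRowTransport.exists_translate` / `pointFloorRow_of_algEquiv`.
[OURS · assembly of landed theorems; cite: GortzWedhorn2020, (13.19)] -/
theorem pointFloorRow_bedT_class (k : Type) [Field k] [IsAlgClosed k] [CharP k 3] (f : MvPolynomial (Fin 5) k)
    (hf : f = X 4 ^ 2 + X 0 ^ 4 * X 4 + X 1 ^ 4 + X 2 ^ 4 + X 3 ^ 5) :
    ∀ (v' : Spec (.of (MvPolynomial (Fin 5) k ⧸ Ideal.span {f}))),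
      v'.asIdeal = Ideal.span (Set.range fun j : Fin 5 => Ideal.Quotient.mk (Ideal.span {f}) (X j)) →
      ∀ (S' : Scheme.{0}) (g₁ : S' ⟶ Spec ((Spec (.of (MvPolynomial (Fin 5) k ⧸ Ideal.span {f}))).presheaf.stalk v')),
        IsBlowup g₁ ((affineBlowup.idealSheaf (Ideal.span (Set.range fun j : Fin 5 => Ideal.Quotient.mk (Ideal.span {f}) (X j)))).comap
          ((Spec (.of (MvPolynomial (Fin 5) k ⧸ Ideal.span {f}))).fromSpecStalk v')) →
        (((affineBlowup.idealSheaf (Ideal.span (Set.range fun j : Fin 5 => Ideal.Quotient.mk (Ideal.span {f}) (X j)))).comap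
            ((Spec (.of (MvPolynomial (Fin 5) k ⧸ Ideal.span {f}))).fromSpecStalk v')) ≠ ⊥ ∧
          ((((affineBlowup.idealSheaf (Ideal.span (Set.range fun j : Fin 5 => Ideal.Quotient.mk (Ideal.span {f}) (X j)))).comap
            ((Spec (.of (MvPolynomial (Fin 5) k ⧸ Ideal.span {f}))).fromSpecStalk v')).support :
              Set (Spec ((Spec (.of (MvPolynomial (Fin 5) k ⧸ Ideal.span {f}))).presheaf.stalk v'))) ⊆
            (Scheme.regularLocus (Spec ((Spec (.of (MvPolynomial (Fin 5) k ⧸ Ideal.span {f}))).presheaf.stalk v')))ᶜ) ∧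
          (∀ s : S', g₁.base s ≠ closedPoint _ → s ∈ Scheme.regularLocus S') ∧ (∀ s : S', CMCl (S'.presheaf.stalk s))) ∧
        (∃ s : S', g₁.base s = closedPoint _ ∧ ¬ FullCl 3 (S'.presheaf.stalk s)) ∧
        (∃ 𝓚 : S'.IdealSheafData, 𝓚 ≠ ⊥ ∧ (∀ s ∈ (𝓚.support : Set S'), g₁.base s = closedPoint _) ∧
          ∀ (S'' : Scheme.{0}) (π : S'' ⟶ S'), IsBlowup π 𝓚 → ∀ s : S'', FullCl 3 (S''.presheaf.stalk s)) :=
  by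
  obtain ⟨φ, hφ, h₁, h₂⟩ := PolyAutRowTransport.exists_translate k (0 : Fin 5) 4 (by decide) (1 : k) 4 (by norm_num)
  exact PolyAutRowTransport.pointFloorRow_of_algEquiv k 3 φ h₁ h₂ f _ (by rw [hφ]; exact aeval_shift_fT k f _ hf rfl)
    (fun v hv S' g₁ hg₁ => f4pos_row_shiftT_class k _ rfl v hv S' g₁ hg₁)

/-- ★★★ **`FInjectivizationGermAt 3 v` AT THE VERTEX OF BED T, BY THE CLASS ROUTE** (`k = k̄`, char 3): §4 for `f_T′` transported by `PolyAutRowTransport.fInjectivizationGermAt_of_algEquiv`.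
[OURS · assembly of landed theorems; cite: GortzWedhorn2020, (13.19)] -/
theorem bedT_fInjectivizationGermAt_class (k : Type) [Field k] [IsAlgClosed k] [CharP k 3] (f : MvPolynomial (Fin 5) k)
    (hf : f = X 4 ^ 2 + X 0 ^ 4 * X 4 + X 1 ^ 4 + X 2 ^ 4 + X 3 ^ 5) :
    ∀ v' : Spec (.of (MvPolynomial (Fin 5) k ⧸ Ideal.span {f})),
      v'.asIdeal = Ideal.span (Set.range fun j : Fin 5 => Ideal.Quotient.mk (Ideal.span {f}) (X j)) → FInjectivizationGermAt 3 v' :=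
  by
  obtain ⟨φ, hφ, h₁, h₂⟩ := PolyAutRowTransport.exists_translate k (0 : Fin 5) 4 (by decide) (1 : k) 4 (by norm_num)
  exact PolyAutRowTransport.fInjectivizationGermAt_of_algEquiv k 3 φ h₁ h₂ f _ (by rw [hφ]; exact aeval_shift_fT k f _ hf rfl)
    (fun v hv => shiftT_fInjectivizationGermAt k _ rfl v hv)

end Summit.ResolutionOfSingularities.ResolutionOfSingularities.Theorems.FInjectiveMacaulayfication.Lx3p3ShiftPointFloorRowClass

end
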